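import Summits.Ventures.PercRepro.Night4T3C3Q7M0Z
import Summits.Ventures.PercRepro.Night4T3C4Q7M0Z
import Summits.Ventures.PercRepro.Night4T3C5Q7M0Z
import Summits.Ventures.PercRepro.Night4T3C6Q7M0Z
import Summits.Ventures.PercRepro.Night4T3C7Q7M0Z
import Summits.Ventures.PercRepro.Night4T3C8Q7M0Z
import Summits.Ventures.PercRepro.Night4T3C9Q7M0Z
import Summits.Ventures.PercRepro.Night4T3C10Q7M0Z
import Summits.Ventures.PercRepro.Night4T3C11Q7M0Z
import Summits.Ventures.PercRepro.Night4T3C12Q7M0Z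
import Summits.Ventures.PercRepro.Night4T3C13Q7M0Z
import Summits.Ventures.PercRepro.Night4T3C14Q7M0Z
import Summits.Ventures.PercRepro.Night4T3C15Q7M0Z
import Summits.Ventures.PercRepro.Night4T3C16Q7M0Z
import Summits.Ventures.PercRepro.Night4T3C17Q7M0Z
import Summits.Ventures.PercRepro.Night4T3C18Q7M0Z
import Summits.Ventures.PercRepro.Night4T3C19Q7M0Z
import Summits.Ventures.PercRepro.Night4T3C20Q7M0Z
import Summits.Ventures.PercRepro.Night4T3C21Q7M0Z
import Summits.Ventures.PercRepro.Night4T3C22Q7M0Z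
import Summits.Ventures.PercRepro.Night4T3C23Q7M0Z
import Summits.Ventures.PercRepro.GenQNineSevenResidue

/-!
# PercRepro — the `(9, 7)` row: the type-`3` residue assembled (night-4, gen 17)
`jq_t3_residue_seven` assembles the certificates `jq_t3_nonneg_c{d}_q7_m0` (`_two_level` where the one-level table was negative) over the coranks `3 … 23` of `HighLayersSevenResidue` at type `3`.
-/
namespace PercRepro.Night4

open Finset ThmH SixFour GenQ PerFlat Star NightThree ThmN

variable {α : Type} [DecidableEq α] {M : Matroid α} [M.Finite]

/-- **The type-`3` residue of `HighLayersSevenResidue`** on a matroid with the six hypotheses: the coranks `3 … 23`, one certificate each (the two-level ones where the one-level table was negative). -/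
theorem jq_t3_residue_seven (hs : Simple M) (hline : ∀ L ∈ flatsQ M 2, L.card ≤ 3) (hplane : ∀ P ∈ flatsQ M 3, P.card ≤ 6) (hsolid : ∀ F ∈ flatsQ M 4, F.card ≤ 10) (hflat5 : ∀ F ∈ flatsQ M 5, F.card ≤ 21) (hflat6 : ∀ F ∈ flatsQ M 6, F.card ≤ 43) {G : Finset α} (hG : G ⊆ gr M) (hrG : M.eRk (G : Set α) = ((7 : ℕ) : ℕ∞)) (hmG : mTr M G = 0) (hlo : 7 + 3 ≤ G.card) (hhi : G.card < 31) : 0 ≤ Jq M G 7 3 := by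
  obtain ⟨d, hd⟩ : ∃ d, G.card = 7 + d := ⟨G.card - 7, by omega⟩
  have h1 : 3 ≤ d := by omega
  have h2 : d ≤ 23 := by omega
  interval_cases d
  · exact jq_t3_nonneg_c3_q7_m0 hs hline hplane hsolid hflat5 hflat6 hG hrG hd hmG
  · exact jq_t3_nonneg_c4_q7_m0 hs hline hplane hsolid hflat5 hflat6 hG hrG hd hmG
  · exact jq_t3_nonneg_c5_q7_m0 hs hline hplane hsolid hflat5 hflat6 hG hrG hd hmG
  · exact jq_t3_nonneg_c6_q7_m0 hs hline hplane hsolid hflat5 hflat6 hG hrG hd hmG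
  · exact jq_t3_nonneg_c7_q7_m0 hs hline hplane hsolid hflat5 hflat6 hG hrG hd hmG
  · exact jq_t3_nonneg_c8_q7_m0 hs hline hplane hsolid hflat5 hflat6 hG hrG hd hmG
  · exact jq_t3_nonneg_c9_q7_m0 hs hline hplane hsolid hflat5 hflat6 hG hrG hd hmG
  · exact jq_t3_nonneg_c10_q7_m0 hs hline hplane hsolid hflat5 hflat6 hG hrG hd hmG
  · exact jq_t3_nonneg_c11_q7_m0 hs hline hplane hsolid hflat5 hflat6 hG hrG hd hmG
  · exact jq_t3_nonneg_c12_q7_m0 hs hline hplane hsolid hflat5 hflat6 hG hrG hd hmG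
  · exact jq_t3_nonneg_c13_q7_m0 hs hline hplane hsolid hflat5 hflat6 hG hrG hd hmG
  · exact jq_t3_nonneg_c14_q7_m0 hs hline hplane hsolid hflat5 hflat6 hG hrG hd hmG
  · exact jq_t3_nonneg_c15_q7_m0 hs hline hplane hsolid hflat5 hflat6 hG hrG hd hmG
  · exact jq_t3_nonneg_c16_q7_m0 hs hline hplane hsolid hflat5 hflat6 hG hrG hd hmG
  · exact jq_t3_nonneg_c17_q7_m0 hs hline hplane hsolid hflat5 hflat6 hG hrG hd hmG
  · exact jq_t3_nonneg_c18_q7_m0 hs hline hplane hsolid hflat5 hflat6 hG hrG hd hmG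
  · exact jq_t3_nonneg_c19_q7_m0 hs hline hplane hsolid hflat5 hflat6 hG hrG hd hmG
  · exact jq_t3_nonneg_c20_q7_m0 hs hline hplane hsolid hflat5 hflat6 hG hrG hd hmG
  · exact jq_t3_nonneg_c21_q7_m0 hs hline hplane hsolid hflat5 hflat6 hG hrG hd hmG
  · exact jq_t3_nonneg_c22_q7_m0 hs hline hplane hsolid hflat5 hflat6 hG hrG hd hmG
  · exact jq_t3_nonneg_c23_q7_m0 hs hline hplane hsolid hflat5 hflat6 hG hrG hd hmG

end PercRepro.Night4
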